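import Summits.AtomisticToContinuum.FouriersLaw.Theorems.BondHeatUncertaintyExtensiveSnapshotIrreversibilityEnergyWindowDilationDuhamelB

/-!
# DilationDuhamel (part W): the dilation commutator identity, kernel-side abbreviations, the five pieces (Dᵛ)/(EBᵃ)/(EBᵈ)/(XBⁿ)/(XBᶠ) and the junction — part 3 of 3 (sequel of `…BondHeatUncertaintyExtensiveSnapshotIrreversibilityEnergyWindowDilationDuhamelB`)

Split for the 400-line cap by the landing lane (hand-2 g33); the module docstring of part 1 (`…BondHeatUncertaintyExtensiveSnapshotIrreversibilityEnergyWindowDilationDuhamelA`) describes the whole node.  Same namespace; all FQNs unchanged.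
0 sorry; standard axioms.
-/

noncomputable section

namespace Summit.AtomisticToContinuum.FouriersLaw.Theorems.ExtensiveSnapshotIrreversibility.EnergyWindow

open MeasureTheory Filter Topology Real intervalIntegral
open scoped ENNReal NNReal ContDiff
open Literature.MathematicalPhysics.KineticTheory.HeatConduction
open Literature.Probability.Process

variable {N : ℕ}

/-! ## 2. Kernel-side abbreviations for the two-temperature chain `δ` -/

/-- `u^δ_r := P^δ_r h` (baths `T ± δ/2`) at real time `r ≥ 0`, as a function of the starting
point (`pertKernel`, part «KernelDuhamelSplit»). [folklore] -/
def pertKernelFun (ω₂ lam β γ T δ : ℝ) (N : ℕ) (h : PhaseSpace N → ℝ) (r : ℝ) :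
    PhaseSpace N → ℝ :=
  fun w => ∫ y, h y ∂(pertKernel ω₂ lam β γ T δ N r w)

/-- The **arrival dilation term** `P^δ_1 (D_b h)(z) = ∫ p_b ∂_{p_b} h dP^δ_1(z,·)`. [folklore] -/
def dilationArrival (ω₂ lam β γ T δ : ℝ) (N : ℕ) (b : Fin N) (h : PhaseSpace N → ℝ)
    (z : PhaseSpace N) : ℝ :=
  ∫ y, momDilation b h y ∂(pertKernel ω₂ lam β γ T δ N 1 z)

/-- The **departure dilation term** `D_b (P^δ_1 h)(z) = z_{p_b} ∂_{p_b}(P^δ_1 h)(z)`. [folklore] -/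
def dilationDeparture (ω₂ lam β γ T δ : ℝ) (N : ℕ) (b : Fin N) (h : PhaseSpace N → ℝ)
    (z : PhaseSpace N) : ℝ :=
  momDilation b (pertKernelFun ω₂ lam β γ T δ N h 1) z

/-- The **exchange integrand** `X_b(s) = P^δ_s (𝒜_b P^δ_{1−s} h)(z)` (FIRST-order derivatives of
`u^δ_{1−s}` at the bath site `b`, coefficients `p_b`, `∂_{q_b}H`). [folklore] -/
def exchangeIntegrand (ω₂ lam β γ T δ : ℝ) (N : ℕ) (b : Fin N) (h : PhaseSpace N → ℝ)
    (z : PhaseSpace N) (s : ℝ) : ℝ :=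
  ∫ w, bathExchange (pinnedChain ω₂ lam β γ) N b (pertKernelFun ω₂ lam β γ T δ N h (1 - s)) w
    ∂(pertKernel ω₂ lam β γ T δ N s z)

/-- The **dilation Duhamel term** at bath site `b`:
`𝔇_b = P^δ_1(D_b h)(z) − D_b(P^δ_1 h)(z) + ∫₀¹ P^δ_s(𝒜_b P^δ_{1−s} h)(z) ds`
(`= ∫₀¹ P^δ_s ([L^δ, D_b] + 𝒜_b) P^δ_{1−s} h (z) ds`, the commutator part telescoping).
[folklore] -/
def dilationDuhamelTerm (ω₂ lam β γ T δ : ℝ) (N : ℕ) (b : Fin N) (h : PhaseSpace N → ℝ)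
    (z : PhaseSpace N) : ℝ :=
  dilationArrival ω₂ lam β γ T δ N b h z - dilationDeparture ω₂ lam β γ T δ N b h z +
    ∫ s in (0 : ℝ)..1, exchangeIntegrand ω₂ lam β γ T δ N b h z s

/-! ## 3. The five pieces -/

/-- **(Dᵛ) the dilation Duhamel** (INSTRUMENTABLE · the hands' (Dˢ) toolset; its generator-level
content is `hasDerivAt_generator_temperature_dilation`, PROVED): for `N ≥ 2`, `T > 0`, smooth
compactly supported `h` and `|δ| < δ₀ ≤ 2T`, the map `δ' ↦ P^{δ'}_1 h(z)` (baths `T ± δ'/2`) is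
differentiable at `δ` with derivative
`(4(T+δ/2))⁻¹ 𝔇_L − (4(T−δ/2))⁻¹ 𝔇_R`, `𝔇_b = P_1(D_b h) − D_b(P_1 h) + ∫₀¹ P_s 𝒜_b P_{1−s} h ds`
(all kernels those of the `δ`-chain; `dilationDuhamelTerm`).  Route: Duhamel in the temperature
at a variable base (`P^{δ+ε}_1 − P^δ_1 = ∫₀¹ P^{δ+ε}_s (L^{δ+ε} − L^δ) P^δ_{1−s} ds`, the (Dˢ)
computation), weak continuity of the kernel in `ε`, the identity
`generator_temperature_deriv_eq_dilation` inside, and Dynkin for the smooth polynomially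
weighted test functions `s ↦ P_s(D_b P_{1−s} h)` (telescoping of the commutator).
Why it might fail: only through bookkeeping (growth of `D_b P_{1−s} h`, which is `p_b` times a
bounded smooth function — moments of all orders exist, CEHR (3.4)); no estimate uniform in `h` is
asked. (after CuneoEckmannHairerReyBellet2018, §3 (3.2); EngelNagel2000, §III.1)
[route leaf · named hypothesis of this cell, NOT filed as a literature fact] -/
def KernelTemperatureDilationDuhamel : Prop :=
  ∀ ω₂ lam β γ : ℝ, 0 < ω₂ → 0 < lam → 0 < β → 0 < γ →
    ∀ T : ℝ, 0 < T → ∀ (N : ℕ) (hN : 2 ≤ N),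
      ∃ δ₀ : ℝ, 0 < δ₀ ∧ ∀ δ : ℝ, |δ| < δ₀ →
        ∀ (h : PhaseSpace N → ℝ), ContDiff ℝ ∞ h → HasCompactSupport h →
          ∀ z : PhaseSpace N,
            HasDerivAt (fun δ' => ∫ y, h y ∂(pertKernel ω₂ lam β γ T δ' N 1 z))
              ((4 * (T + δ / 2))⁻¹ * dilationDuhamelTerm ω₂ lam β γ T δ N (leftBath N hN) h z -
                (4 * (T - δ / 2))⁻¹ * dilationDuhamelTerm ω₂ lam β γ T δ N (rightBath N hN) h z)
              δ

/-- **(EBᵃ) arrival dilation bound** (ORDER 1 · momentum direction · ATTACKABLE): uniformly in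
`|δ| < δ₀`, `|P^δ_1(p_b ∂_{p_b} h)(z)| ≤ C e^{θ' H(z)}` for smooth compactly supported
`|h| ≤ e^{θH}`, `b` a bath site.  Route: integrate `∂_{p_b}` by parts onto the time-1 density
(`∫ p_b ∂_{p_b}h p = −∫ h p − ∫ h p_b ∂_{y_{p_b}} p`), i.e. an ARRIVAL dual of orders `{2}` ⊂ (SD₁)
at `s = 1` with `G = h p_b e^{−θH} · e^{θH}`-type Hölder, plus CEHR (3.4) for the weights.
Why it might fail: the polynomial factor `p_b` costs `e^{θH} → e^{θ₁H}`, `θ < θ₁ < θ'` — harmless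
as typed (`θ < θ'` strict). (after CuneoEckmannHairerReyBellet2018, §3 (3.4); Nualart2006,
Prop. 2.1.4) [route leaf · named hypothesis of this cell, NOT filed as a literature fact] -/
def DilationArrivalBound : Prop :=
  ∀ ω₂ lam β γ : ℝ, 0 < ω₂ → 0 < lam → 0 < β → 0 < γ →
    ∀ T : ℝ, 0 < T → ∀ (N : ℕ) (hN : 2 ≤ N), ∀ θ θ' : ℝ, 0 < θ → θ < θ' → θ' < 1 / T →
      ∃ δ₀ C : ℝ, 0 < δ₀ ∧ ∀ δ : ℝ, |δ| < δ₀ →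
        ∀ (h : PhaseSpace N → ℝ), ContDiff ℝ ∞ h → HasCompactSupport h →
          (∀ y, |h y| ≤ Real.exp (θ * (pinnedChain ω₂ lam β γ).hamiltonian N y)) →
          ∀ b : Fin N, (b = leftBath N hN ∨ b = rightBath N hN) → ∀ z : PhaseSpace N,
            |dilationArrival ω₂ lam β γ T δ N b h z| ≤
              C * Real.exp (θ' * (pinnedChain ω₂ lam β γ).hamiltonian N z)

/-- **(EBᵈ) departure dilation bound** (ORDER 1 · momentum direction · ATTACKABLE): uniformly
in `|δ| < δ₀`, `|z_{p_b} ∂_{p_b}(P^δ_1 h)(z)| ≤ C e^{θ' H(z)}` for smooth compactly supported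
`|h| ≤ e^{θH}`, `b` a bath site.  Route: differentiation under the integral at time 1
(`hasDerivAt_integral_mul_density`, part V) and a DEPARTURE dual of orders `{0}` ⊂ (SD₁) at
`s = 1` (Bismut–Elworthy–Li weight of the `δ`-chain), the factor `|z_{p_b}| ≤ C_ε e^{εH(z)}`
absorbed by `θ < θ'`.  Why it might fail: needs the (SD₁) constants uniform in the
two-temperature parameter `|δ| < δ₀` (they are: (MC∞) is stated for all `T_L, T_R` in a compact
range). (after Bismut1984; ElworthyLi1994, Thm 2.1; CuneoEckmannHairerReyBellet2018, §3)
[route leaf · named hypothesis of this cell, NOT filed as a literature fact] -/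
def DilationDepartureBound : Prop :=
  ∀ ω₂ lam β γ : ℝ, 0 < ω₂ → 0 < lam → 0 < β → 0 < γ →
    ∀ T : ℝ, 0 < T → ∀ (N : ℕ) (hN : 2 ≤ N), ∀ θ θ' : ℝ, 0 < θ → θ < θ' → θ' < 1 / T →
      ∃ δ₀ C : ℝ, 0 < δ₀ ∧ ∀ δ : ℝ, |δ| < δ₀ →
        ∀ (h : PhaseSpace N → ℝ), ContDiff ℝ ∞ h → HasCompactSupport h →
          (∀ y, |h y| ≤ Real.exp (θ * (pinnedChain ω₂ lam β γ).hamiltonian N y)) →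
          ∀ b : Fin N, (b = leftBath N hN ∨ b = rightBath N hN) → ∀ z : PhaseSpace N,
            |dilationDeparture ω₂ lam β γ T δ N b h z| ≤
              C * Real.exp (θ' * (pinnedChain ω₂ lam β γ).hamiltonian N z)

/-- **(XBⁿ) exchange term bound, near half** `s ∈ (0, ½]` (ORDER 1 · directions `p_b` AND `q_b` ·
ATTACKABLE): uniformly in `|δ| < δ₀`,
`|P^δ_s(p_b ∂_{q_b} u + (∂_{q_b}H) ∂_{p_b} u)(z)| ≤ C e^{θ'H(z)}`, `u = P^δ_{1−s} h`,
`1−s ∈ [½, 1)`.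
Route: `∂_{q_b} u`, `∂_{p_b} u` are DEPARTURE derivatives of the kernel at time `1−s ≥ ½`
(orders `{0}`, directions `e_{p_b}` — (SD₁) — and `e_{q_b}` — its position twin (SD₁q), same
skeleton Gram matrix), giving `|∇_b u| ≤ C e^{θ₁H}`; then `|p_b|, |∂_{q_b}H| ≤ C_ε e^{εH}` and CEHR
(3.4) at time `s` (valid down to `s → 0`, where `P_s → id`).  Why it might fail: the position
direction needs the `q`-rows of the inverse Gram moments — covered by (MC∞) (full `2N × 2N`
matrix) but not yet plumbed (`SkeletonWeights` hard-wires `momCoord`).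
(after CuneoEckmannHairerReyBellet2018, §3 (3.2)–(3.4); Norris1986, Thm 3.2)
[route leaf · named hypothesis of this cell, NOT filed as a literature fact] -/
def ExchangeTermBoundNear : Prop :=
  ∀ ω₂ lam β γ : ℝ, 0 < ω₂ → 0 < lam → 0 < β → 0 < γ →
    ∀ T : ℝ, 0 < T → ∀ (N : ℕ) (hN : 2 ≤ N), ∀ θ θ' : ℝ, 0 < θ → θ < θ' → θ' < 1 / T →
      ∃ δ₀ C : ℝ, 0 < δ₀ ∧ ∀ δ : ℝ, |δ| < δ₀ →
        ∀ (h : PhaseSpace N → ℝ), ContDiff ℝ ∞ h → HasCompactSupport h →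
          (∀ y, |h y| ≤ Real.exp (θ * (pinnedChain ω₂ lam β γ).hamiltonian N y)) →
          ∀ b : Fin N, (b = leftBath N hN ∨ b = rightBath N hN) → ∀ z : PhaseSpace N,
            ∀ s : ℝ, 0 < s → s ≤ 1 / 2 →
              |exchangeIntegrand ω₂ lam β γ T δ N b h z s| ≤
                C * Real.exp (θ' * (pinnedChain ω₂ lam β γ).hamiltonian N z)

/-- **(XBᶠ) exchange term bound, far half** `s ∈ [½, 1]` (ORDER 1 · directions `p_b` AND `q_b` ·
ATTACKABLE): the same bound for `s ≥ ½`, where `u = P^δ_{1−s} h` is a SHORT-time evolution and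
its derivatives are not uniformly controlled; instead integrate by parts onto the time-`s`
density: `∫ (w_{p_b} ∂_{q_b} u + ∂_{q_b}H ∂_{p_b} u) p_s(z, w) dw
 = −∫ u (w_{p_b} ∂_{w_{q_b}} p_s + ∂_{q_b}H ∂_{w_{p_b}} p_s) dw` (the cross terms
`∂_{q_b} w_{p_b} = 0 = ∂_{p_b} ∂_{q_b} H` vanish — `𝒜_b` is divergence-free), i.e. ARRIVAL duals
of orders `{2}` at time `s ∈ [½, 1]` in the directions `e_{q_b}`, `e_{p_b}` with polynomially
weighted `G = u p_b`, `u ∂_{q_b}H` (`|u| ≤ C e^{θ₁H}` by CEHR), after a smooth truncation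
(pattern `perturbedKernelHessianIBP_of_compact`).  Why it might fail: as (XBⁿ) — the `q_b` rows of
the Gram inverse; and the truncation error must vanish (Gaussian tails of `p_s`, CEHR (3.3)).
(after CuneoEckmannHairerReyBellet2018, §3 (3.3)–(3.4); Nualart2006, Prop. 2.1.4)
[route leaf · named hypothesis of this cell, NOT filed as a literature fact] -/
def ExchangeTermBoundFar : Prop :=
  ∀ ω₂ lam β γ : ℝ, 0 < ω₂ → 0 < lam → 0 < β → 0 < γ →
    ∀ T : ℝ, 0 < T → ∀ (N : ℕ) (hN : 2 ≤ N), ∀ θ θ' : ℝ, 0 < θ → θ < θ' → θ' < 1 / T →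
      ∃ δ₀ C : ℝ, 0 < δ₀ ∧ ∀ δ : ℝ, |δ| < δ₀ →
        ∀ (h : PhaseSpace N → ℝ), ContDiff ℝ ∞ h → HasCompactSupport h →
          (∀ y, |h y| ≤ Real.exp (θ * (pinnedChain ω₂ lam β γ).hamiltonian N y)) →
          ∀ b : Fin N, (b = leftBath N hN ∨ b = rightBath N hN) → ∀ z : PhaseSpace N,
            ∀ s : ℝ, 1 / 2 ≤ s → s ≤ 1 →
              |exchangeIntegrand ω₂ lam β γ T δ N b h z s| ≤
                C * Real.exp (θ' * (pinnedChain ω₂ lam β γ).hamiltonian N z)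

/-! ## 4. The junction -/

/-- Pointwise bound of the dilation Duhamel term from the four order-one bounds
(`‖∫₀¹ X‖ ≤ sup ‖X‖`, no integrability needed). [folklore] -/
theorem abs_dilationDuhamelTerm_le {ω₂ lam β γ T δ : ℝ} {b : Fin N}
    {h : PhaseSpace N → ℝ} {z : PhaseSpace N} {E CA CD CN CF : ℝ}
    (hA : |dilationArrival ω₂ lam β γ T δ N b h z| ≤ CA * E)
    (hD : |dilationDeparture ω₂ lam β γ T δ N b h z| ≤ CD * E)
    (hn : ∀ s : ℝ, 0 < s → s ≤ 1 / 2 → |exchangeIntegrand ω₂ lam β γ T δ N b h z s| ≤ CN * E)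
    (hf : ∀ s : ℝ, 1 / 2 ≤ s → s ≤ 1 → |exchangeIntegrand ω₂ lam β γ T δ N b h z s| ≤ CF * E)
    (hE : 0 ≤ E) :
    |dilationDuhamelTerm ω₂ lam β γ T δ N b h z| ≤ (|CA| + |CD| + (|CN| + |CF|)) * E := by
  have hI : |∫ s in (0 : ℝ)..1, exchangeIntegrand ω₂ lam β γ T δ N b h z s| ≤
      (|CN| + |CF|) * E := by
    have key := intervalIntegral.norm_integral_le_of_norm_le_const (a := (0 : ℝ)) (b := 1)
      (f := exchangeIntegrand ω₂ lam β γ T δ N b h z) (C := (|CN| + |CF|) * E)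
      (fun s hs => ?_)
    · simpa using key
    · rw [Set.uIoc_of_le zero_le_one] at hs
      rw [Real.norm_eq_abs]
      rcases le_or_gt s (1 / 2) with hs2 | hs2
      · calc |exchangeIntegrand ω₂ lam β γ T δ N b h z s| ≤ CN * E := hn s hs.1 hs2
          _ ≤ |CN| * E := mul_le_mul_of_nonneg_right (le_abs_self _) hE
          _ ≤ (|CN| + |CF|) * E := by nlinarith [abs_nonneg CF]
      · calc |exchangeIntegrand ω₂ lam β γ T δ N b h z s| ≤ CF * E := hf s hs2.le hs.2
          _ ≤ |CF| * E := mul_le_mul_of_nonneg_right (le_abs_self _) hE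
          _ ≤ (|CN| + |CF|) * E := by nlinarith [abs_nonneg CN]
  have hA' : |dilationArrival ω₂ lam β γ T δ N b h z| ≤ |CA| * E :=
    hA.trans (mul_le_mul_of_nonneg_right (le_abs_self _) hE)
  have hD' : |dilationDeparture ω₂ lam β γ T δ N b h z| ≤ |CD| * E :=
    hD.trans (mul_le_mul_of_nonneg_right (le_abs_self _) hE)
  unfold dilationDuhamelTerm
  calc |dilationArrival ω₂ lam β γ T δ N b h z - dilationDeparture ω₂ lam β γ T δ N b h z +
          ∫ s in (0 : ℝ)..1, exchangeIntegrand ω₂ lam β γ T δ N b h z s|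
        ≤ |dilationArrival ω₂ lam β γ T δ N b h z| + |dilationDeparture ω₂ lam β γ T δ N b h z| +
          |∫ s in (0 : ℝ)..1, exchangeIntegrand ω₂ lam β γ T δ N b h z s| := by
        refine (abs_add_le _ _).trans ?_
        gcongr
        exact abs_sub _ _
    _ ≤ |CA| * E + |CD| * E + (|CN| + |CF|) * E := by gcongr
    _ = (|CA| + |CD| + (|CN| + |CF|)) * E := by ring

/-- ★★ **`(Dᵛ) → (EBᵃ) → (EBᵈ) → (XBⁿ) → (XBᶠ) → S3ˢ`** (`KernelTemperatureLipschitzSmooth`): the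
mean-value inequality for `δ' ↦ P^{δ'}_1 h(z)` on `(−δ₀, δ₀)`, `δ₀ ≤ T`, with the derivative (Dᵛ)
bounded by `(B/T) e^{θ'H(z)}`, `B = |C_a| + |C_d| + |C_n| + |C_f|` (`(4(T ± δ'/2))⁻¹ ≤ (2T)⁻¹`).
NO second-order quantity is used. [folklore] -/
theorem kernelTemperatureLipschitzSmooth_of_dilation (hV : KernelTemperatureDilationDuhamel)
    (hA : DilationArrivalBound) (hDp : DilationDepartureBound) (hNr : ExchangeTermBoundNear)
    (hFr : ExchangeTermBoundFar) : KernelTemperatureLipschitzSmooth := by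
  intro ω₂ lam β γ hω hl hβ hγ T hT N hN θ θ' hθ hθθ' hθ'1
  obtain ⟨δV, hδV, hVm⟩ := hV ω₂ lam β γ hω hl hβ hγ T hT N hN
  obtain ⟨δA, CA, hδA, hAm⟩ := hA ω₂ lam β γ hω hl hβ hγ T hT N hN θ θ' hθ hθθ' hθ'1
  obtain ⟨δD, CD, hδD, hDm⟩ := hDp ω₂ lam β γ hω hl hβ hγ T hT N hN θ θ' hθ hθθ' hθ'1
  obtain ⟨δN, CN, hδN, hNm⟩ := hNr ω₂ lam β γ hω hl hβ hγ T hT N hN θ θ' hθ hθθ' hθ'1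
  obtain ⟨δF, CF, hδF, hFm⟩ := hFr ω₂ lam β γ hω hl hβ hγ T hT N hN θ θ' hθ hθθ' hθ'1
  set Hm := (pinnedChain ω₂ lam β γ).hamiltonian N with hHm
  set B : ℝ := |CA| + |CD| + (|CN| + |CF|) with hB
  set δ₀ : ℝ := min (min δV T) (min (min δA δD) (min δN δF)) with hδ₀
  have hδ₀pos : 0 < δ₀ := by positivity
  refine ⟨δ₀, B / T, hδ₀pos, fun δ hδ z h hhC hhc hh => ?_⟩
  set E : ℝ := Real.exp (θ' * Hm z) with hE
  have hE0 : 0 ≤ E := (Real.exp_pos _).le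
  have hB0 : 0 ≤ B := by positivity
  -- the interval `I = (-δ₀, δ₀)` and the derivative along it
  set I : Set ℝ := Set.Ioo (-δ₀) δ₀ with hI
  set φ : ℝ → ℝ := fun δ' => ∫ y, h y ∂(pertKernel ω₂ lam β γ T δ' N 1 z) with hφ
  set φ' : ℝ → ℝ := fun δ' =>
    (4 * (T + δ' / 2))⁻¹ * dilationDuhamelTerm ω₂ lam β γ T δ' N (leftBath N hN) h z -
      (4 * (T - δ' / 2))⁻¹ * dilationDuhamelTerm ω₂ lam β γ T δ' N (rightBath N hN) h z with hφ'
  have hmemI : ∀ δ' ∈ I, |δ'| < δ₀ := fun δ' hδ' => abs_lt.2 hδ'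
  have hder : ∀ δ' ∈ I, HasDerivWithinAt φ (φ' δ') I δ' := fun δ' hδ' =>
    (hVm δ' ((hmemI δ' hδ').trans_le ((min_le_left _ _).trans (min_le_left _ _))) h hhC hhc
      z).hasDerivWithinAt
  have hbd : ∀ δ' ∈ I, ‖φ' δ'‖ ≤ B / T * E := by
    intro δ' hδ'
    have h0 := hmemI δ' hδ'
    have hδ'T : |δ'| < T := h0.trans_le ((min_le_left _ _).trans (min_le_right _ _))
    have hδ'A : |δ'| < δA :=
      h0.trans_le ((min_le_right _ _).trans ((min_le_left _ _).trans (min_le_left _ _)))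
    have hδ'D : |δ'| < δD :=
      h0.trans_le ((min_le_right _ _).trans ((min_le_left _ _).trans (min_le_right _ _)))
    have hδ'N : |δ'| < δN :=
      h0.trans_le ((min_le_right _ _).trans ((min_le_right _ _).trans (min_le_left _ _)))
    have hδ'F : |δ'| < δF :=
      h0.trans_le ((min_le_right _ _).trans ((min_le_right _ _).trans (min_le_right _ _)))
    have habs := abs_lt.1 hδ'T
    have hTL : T / 2 < T + δ' / 2 := by linarith
    have hTR : T / 2 < T - δ' / 2 := by linarith
    have hterm : ∀ b : Fin N, (b = leftBath N hN ∨ b = rightBath N hN) →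
        |dilationDuhamelTerm ω₂ lam β γ T δ' N b h z| ≤ B * E := fun b hb =>
      abs_dilationDuhamelTerm_le (hAm δ' hδ'A h hhC hhc hh b hb z) (hDm δ' hδ'D h hhC hhc hh b hb z)
        (hNm δ' hδ'N h hhC hhc hh b hb z) (hFm δ' hδ'F h hhC hhc hh b hb z) hE0
    have hcoef : ∀ t : ℝ, T / 2 < t → |(4 * t)⁻¹| ≤ (2 * T)⁻¹ := fun t ht => by
      have ht0 : 0 < t := by linarith
      rw [abs_of_pos (by positivity)]
      exact inv_anti₀ (by positivity) (by linarith)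
    rw [Real.norm_eq_abs, hφ']
    calc |(4 * (T + δ' / 2))⁻¹ * dilationDuhamelTerm ω₂ lam β γ T δ' N (leftBath N hN) h z -
            (4 * (T - δ' / 2))⁻¹ * dilationDuhamelTerm ω₂ lam β γ T δ' N (rightBath N hN) h z|
          ≤ |(4 * (T + δ' / 2))⁻¹| * |dilationDuhamelTerm ω₂ lam β γ T δ' N (leftBath N hN) h z| +
            |(4 * (T - δ' / 2))⁻¹| *
              |dilationDuhamelTerm ω₂ lam β γ T δ' N (rightBath N hN) h z| := by
          rw [← abs_mul, ← abs_mul]; exact abs_sub _ _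
      _ ≤ (2 * T)⁻¹ * (B * E) + (2 * T)⁻¹ * (B * E) := by
          gcongr
          · exact hcoef _ hTL
          · exact hterm _ (Or.inl rfl)
          · exact hcoef _ hTR
          · exact hterm _ (Or.inr rfl)
      _ = B / T * E := by field_simp; ring
  have h0I : (0 : ℝ) ∈ I := ⟨by linarith, hδ₀pos⟩
  have hδI : δ ∈ I := abs_lt.1 hδ
  have key := (convex_Ioo (-δ₀) δ₀).norm_image_sub_le_of_norm_hasDerivWithin_le hder hbd h0I hδI
  -- identify the endpoints
  have hφδ : φ δ = ∫ y, h y ∂((pinnedChain ω₂ lam β γ).transitionKernel N (T + δ / 2)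
      (T - δ / 2) 1 z) := by
    simp only [hφ, pertKernel, Real.toNNReal_one]
  have hφ0 : φ 0 = ∫ y, h y ∂((pinnedChain ω₂ lam β γ).transitionKernel N T T 1 z) := by
    simp only [hφ, pertKernel, Real.toNNReal_one, zero_div, add_zero, sub_zero]
  rw [Real.norm_eq_abs, Real.norm_eq_abs, sub_zero, hφδ, hφ0] at key
  calc _ ≤ B / T * E * |δ| := key
    _ = B / T * |δ| * Real.exp (θ' * Hm z) := by rw [hE]; ring

/-- ★★ **`(Dᵛ) → (EBᵃ) → (EBᵈ) → (XBⁿ) → (XBᶠ) → S3`** (`KernelTemperatureLipschitz`, via the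
PROVED density step `kernelTemperatureLipschitz_of_smooth`). [folklore] -/
theorem kernelTemperatureLipschitz_of_dilation (hV : KernelTemperatureDilationDuhamel)
    (hA : DilationArrivalBound) (hDp : DilationDepartureBound) (hNr : ExchangeTermBoundNear)
    (hFr : ExchangeTermBoundFar) : KernelTemperatureLipschitz :=
  kernelTemperatureLipschitz_of_smooth
    (kernelTemperatureLipschitzSmooth_of_dilation hV hA hDp hNr hFr)

/-- ★★ **The junction `K_fix ⟸ A0 ∧ A2 ∧ (Dᵛ) ∧ (EBᵃ) ∧ (EBᵈ) ∧ (XBⁿ) ∧ (XBᶠ) ∧ A3p ∧ A4`**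
(`SnapshotKLUpperExpansion`, via `snapshotKLUpperExpansion_of_atoms₅K`): the order-two layer
(SD₂)/(KD₂)/(G2)/(G2*) of rows 1183–1218 no longer occurs beneath `K_fix`. [folklore] -/
theorem snapshotKLUpperExpansion_of_atoms₉V (h0 : NessGibbsReweighting)
    (h2 : NessOddLogRatioBound) (hV : KernelTemperatureDilationDuhamel)
    (hA : DilationArrivalBound) (hDp : DilationDepartureBound) (hNr : ExchangeTermBoundNear)
    (hFr : ExchangeTermBoundFar) (h3p : NessFloorMeanValue) (h4 : NessLinearResponseL2) :
    SnapshotKLUpperExpansion :=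
  snapshotKLUpperExpansion_of_atoms₅K h0 h2
    (kernelTemperatureLipschitz_of_dilation hV hA hDp hNr hFr) h3p h4

end Summit.AtomisticToContinuum.FouriersLaw.Theorems.ExtensiveSnapshotIrreversibility.EnergyWindow

end
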